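import Summits.Ventures.GridStability.Lyapunov.PolytopeRateKit
import Summits.Ventures.GridStability.Lyapunov.StructurePreservingPolytopeRateRoa
import Summits.Ventures.GridStability.Lyapunov.WSCC9LosslessRate
import Summits.Ventures.GridStability.Lyapunov.WSCC9LosslessPolytopeRoa
import HarnessLib

/-!
# GridStability/Lyapunov/WSCC9LosslessPolytopeRate — «SP-RATE-POLYTOPE» instance: the certified rate
# `1/28 s⁻¹` of ★ #110 for «WSCC9-postB-L-SPdamp» holds on the ★★ #80″ POLYTOPE region
# `{V ≤ 27/100} ∩ 𝒫 ∩ leaf` (4.5× the window level `3/50`), by per-pair endpoint checks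

Cell `gridfusion` (LADDER-GRIDFUSION), seat gridfusion-lyap-1 (g8). OBJECT BY NAME: g4's `WSCC9LffNU.data`
(`Lyapunov/WSCC9LffNonUniformData.lean`, p504302 = model-1's `WSCC9.postB_relL` with the PRINTED
non-uniform damping `D := WSCC9.D_SP`, `D_i/M_i = 1/10, 1/5, 3/10` [cite: SauerPai1998, §7.9.3 Ex. 7.1])
and its real model `data.toModel : ClassicalSwing 3`, read as structure-preserving data with every node a
machine (model-2's `Params.ofClassical`, as in ★ #110's `WSCC9LosslessRate.lean`, p550019). LABEL OF EVERY
MENTION: «synthetic lossless VARIANT of the printed 9-bus with the printed NON-UNIFORM damping — a PIPELINE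
sentence, not a 9-bus sentence» (tokens MV-2L synthetic + MV-RD + MV-SPD + MV-h12).

WHAT CHANGES w.r.t. ★ #110 (rate `1/28 s⁻¹`, gain `42/5`, on `{V ≤ 3/50} ∩ {|δ_i − δ_j| < π/2}`): the
REGION is ★★ #80″'s polytope well `{V ≤ 27/100} ∩ {|(δ_i − δ_j) + (θ*_i − θ*_j)| < π} ∩ leaf`
(`WSCC9LosslessPolytopeRoa.lean`, p538862: `27/100 < C_ij·vtGap(θ*_ij)`), on which the uniform window
gain `g(θ)` is unavailable; instead the per-pair ENDPOINT CERTIFICATE of `StructurePreservingPolytopeRate`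
is checked by ONE `decide` over `ℚ` (`pairChecks`): on `{V ≤ 27/100}` each line angle `δ_i − δ_j` stays
within `θ*_ij −/+ 8·arctan ρ∓_ij` (table `rhoHi`; binding pair machines 1–0: offset `73.8°`, i.e. the
line angle `δ_1 − δ_0` may swing from `θ*_10 = 39.95°` up to ≈ `113.7°`), and on those intervals the
Bregman slope is `m = 209/1000` and the pairing ratio `k = 1` (`Π ≥ W`). The kinetic branch still binds:
`ρ(2 + hB) ≤ 2h` with `h = 1/20`, `B = 2ΣM/ΣD` gives `ρ ≤ 0.03667`, and the line branch
`ρ(1 + hA/m) ≤ hk` with the diameter pair (`d = 1`, `A = 4ΣD/β ≈ 0.1197`) gives `ρ ≤ 0.0486` — so the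
SAME certified rate `1/28 s⁻¹` and gain `42/5` hold on the larger region.

CONTENTS: `rhoHi` (6 rational offsets), `pairChecks` (12 `HiCheck`s, one `decide`), `Cc_diag`
(`C_ii = 0`), `cert` (the `EdgeRateCert` of `ofClassical data.toModel` at level `27/100`), `diam_one`,
`rate_ok`/`gain_ok` (the four scalar side conditions, `norm_num`), and the sentence
**`energy_le_mul_exp_neg_polytope`**. Exact-rational mirror of `pairChecks` with margins:
HOME/lean/tools/lyap-1/sp-polyrate/gen_wscc9.py. THREE COLUMNS: CERTIFIED = the kernel inequalities and the
sentence below for MODEL `data.toModel`; MODELLED = the LABEL; VALIDATED = the float margins quoted in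
docstrings (e.g. true `k_max = 1.028` on the binding endpoint). No sentence of this file says that the WSCC
system or any grid is stable or well damped. No named fact; standard axioms.
-/

noncomputable section

open Set Filter Topology Real Finset
open Summit.Ventures.GridStability.Models
open Summit.Ventures.GridStability.Models.StructurePreserving
open Summit.Ventures.GridStability.Lyapunov.StructurePreserving (EdgeRateCert vtPolytope constraintSet
  phaseEnergy phaseField phaseEnergy_le_mul_exp_neg_vt_diam)
open Summit.Ventures.GridStability.Lyapunov.PolytopeSector (HiCheck edgeRateCert_of_ratChecks)
open Summit.Ventures.GridStability.Lyapunov.WSCC9LffNU (data data_eqData data_Cc_pos)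
open Summit.Ventures.GridStability.Lyapunov.WSCC9LosslessPolytope (Ccoef_eq M_pos D_pos B_symm
  isLossless Ccoef_pos abs_angle_lt isEquilibrium level_lt_pairGap)
open Summit.Ventures.GridStability.Lyapunov.WSCC9LosslessRate (Ccoef_nonneg edge_lower hM_ratio
  sum_M sum_D)
open Literature.MathematicalPhysics.PowerSystems.ClassicalModel.LosslessSystem (vtGap)

namespace Summit.Ventures.GridStability.Lyapunov.WSCC9LosslessPolytopeRate

/-! ### The certificate data and the kernel checks -/

/-- **Endpoint offsets** `ρ⁺_ij` of the test angles `θ*_ij + 8·arctan ρ⁺_ij` (ordered machine pairs; the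
lower test angle of `(i, j)` is the upper one of `(j, i)` read backwards): the smallest offsets on the
`10⁻⁴` grid for which the confinement check at level `27/100` passes (generator `gen_wscc9.py`). Offsets in
degrees: `(0,1) 49.5°, (0,2) 39.8°, (1,0) 73.8°, (1,2) 39.4°, (2,0) 45.3°, (2,1) 37.0°`. -/
def rhoHi : Fin 3 → Fin 3 → ℚ :=
  ![![0, 271 / 2500, 871 / 10000], ![203 / 1250, 0, 861 / 10000], ![62 / 625, 809 / 10000, 0]]

/-- **The twelve endpoint checks (one `decide` over `ℚ`)**: for every ordered pair of distinct machines,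
`HiCheck` at `(sin θ*_ij, cos θ*_ij) = (sd_ij, cd_ij)` with offset `rhoHi i j`, and at `(−sd_ij, cd_ij)`
with offset `rhoHi j i`, coupling `C_ij`, level `27/100`, slope `209/1000`, ratio `1`. CERTIFIED column.
(Float margins: slope binds on the endpoint `(1,0)` at `0.2103`; ratio there `k_max = 1.028`.) [folklore] -/
theorem pairChecks : ∀ i j : Fin 3, i ≠ j →
    HiCheck (data.sd i j) (data.cd i j) (rhoHi i j) (data.Cc i j) (27 / 100) (209 / 1000) 1 ∧
    HiCheck (-data.sd i j) (data.cd i j) (rhoHi j i) (data.Cc i j) (27 / 100) (209 / 1000) 1 := by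
  decide +kernel

/-- The diagonal couplings vanish (`B_ii = 0` in the typed data), so `C_ij ≠ 0` forces `i ≠ j`. -/
theorem Cc_diag : ∀ i : Fin 3, data.Cc i i = 0 := by decide +kernel

/-- A nonzero coupling of the real model is off-diagonal. [folklore] -/
theorem ne_of_Ccoef_ne_zero {i j : Fin 3} (h : data.toModel.Ccoef i j ≠ 0) : i ≠ j := by
  rintro rfl
  rw [Ccoef_eq, Cc_diag] at h
  exact h (by norm_num)

/-- **The per-pair endpoint certificate of `ofClassical data.toModel` at level `27/100`** (slope
`209/1000`, ratio `1`, test angles `θ*_ij ∓/± 8·arctan ρ`), assembled by the kit from `pairChecks` and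
model-1's exact `sin θ*_ij = sd_ij`, `cos θ*_ij = cd_ij`. CERTIFIED column. [folklore] -/
theorem cert : EdgeRateCert (Params.ofClassical data.toModel) data.angleOf (27 / 100) (209 / 1000) 1
    (fun i j => (data.angleOf i - data.angleOf j) - 8 * Real.arctan (rhoHi j i : ℝ))
    (fun i j => (data.angleOf i - data.angleOf j) + 8 * Real.arctan (rhoHi i j : ℝ)) := by
  have h := edgeRateCert_of_ratChecks (p := Params.ofClassical data.toModel) (δ₀ := data.angleOf)
    (fun i j => Ccoef_nonneg i j)
    (fun i j hij => (abs_angle_lt (ne_of_Ccoef_ne_zero hij)).le)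
    data.Cc data.sd data.cd rhoHi (fun i j => rhoHi j i) (27 / 100) (209 / 1000) 1
    (by norm_num) (by norm_num) le_rfl
    (fun i j _ => Ccoef_eq i j)
    (fun i j _ => (data.sd_cast data_eqData i j).symm)
    (fun i j _ => (data.cd_cast data_eqData i j).symm)
    (fun i j hij => (pairChecks i j (ne_of_Ccoef_ne_zero hij)).1)
    (fun i j hij => (pairChecks i j (ne_of_Ccoef_ne_zero hij)).2)
  push_cast at h
  exact h

/-! ### The data facts of the diameter pair and the scalar side conditions -/

/-- Every two machines are joined by a walk of length `≤ 1` in the coupling graph of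
`ofClassical data.toModel` (all `C_ij > 0`: the complete graph `K₃`). [folklore] -/
theorem diam_one : ∀ i j : Fin 3,
    ∃ w : (Params.ofClassical data.toModel).couplingGraph.Walk i j, w.length ≤ 1 := by
  intro i j
  by_cases hij : i = j
  · subst hij
    exact ⟨SimpleGraph.Walk.nil, by simp⟩
  · have hadj : (Params.ofClassical data.toModel).couplingGraph.Adj i j := by
      rw [Params.couplingGraph_adj]
      exact ⟨hij, (Ccoef_pos hij).ne', (Ccoef_pos (Ne.symm hij)).ne'⟩
    exact ⟨SimpleGraph.Walk.cons hadj SimpleGraph.Walk.nil, by simp⟩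

/-- `ΣM = 661/3770` over the generator set of `ofClassical` (= all machines). CERTIFIED. -/
theorem sum_M_gen : ∑ i ∈ (Params.ofClassical data.toModel).gen, (Params.ofClassical data.toModel).M i
    = (661 / 3770 : ℝ) := by
  simp only [Params.ofClassical_gen, Params.ofClassical_M]
  exact sum_M

/-- `ΣD = 4547/188500`. CERTIFIED. -/
theorem sum_D_all : ∑ i, (Params.ofClassical data.toModel).D i = (4547 / 188500 : ℝ) := by
  simp only [Params.ofClassical_D]
  exact sum_D

/-- **The rate side conditions at `ρ = 1/28`, `h = 1/20`, `m = 209/1000`, `k = 1`** (kinetic branch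
`(1/28)(2 + (1/20)·2ΣM/ΣD) ≤ 1/10`, margin at `0.03667`; line branch with the diameter pair `d = 1`,
`β = C_01`: `(1/28)(1 + (1/20)(4ΣD/β)/m) ≤ 1/20`, margin at `0.0486`). CERTIFIED. [folklore] -/
theorem rate_ok :
    (1 / 28 : ℝ) * (2 + 1 / 20 * (2 * (661 / 3770 : ℝ) / (4547 / 188500))) ≤ 2 * (1 / 20) ∧
    (1 / 28 : ℝ) * (1 + 1 / 20 * (4 * ((1 : ℕ) : ℝ) * (4547 / 188500 : ℝ)
      / (161205737693 / 200000000000)) / (209 / 1000)) ≤ 1 / 20 * 1 := by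
  constructor <;> norm_num

/-- **The gain side conditions at `C = 14/5`**: `2 + (1/20)·2ΣM/ΣD ≤ 14/5` and
`1 + (1/20)(4ΣD/β)/m ≤ 14/5`. CERTIFIED. [folklore] -/
theorem gain_ok :
    2 + 1 / 20 * (2 * (661 / 3770 : ℝ) / (4547 / 188500)) ≤ (14 / 5 : ℝ) ∧
    1 + 1 / 20 * (4 * ((1 : ℕ) : ℝ) * (4547 / 188500 : ℝ) / (161205737693 / 200000000000))
      / (209 / 1000) ≤ (14 / 5 : ℝ) := by
  constructor <;> norm_num

/-! ### The sentence -/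

/-- **«WSCC9-postB-L-SPdamp»: the certified rate `1/28 s⁻¹` on the POLYTOPE region of level `27/100`.**
For model-1's real model `data.toModel` (3 machines, PRINTED non-uniform damping
`D_i/M_i = 1/10, 1/5, 3/10`, lossless post-B couplings): every solution `γ = (δ, ω)` on `univ` (tree
convention) whose initial state has every machine pair in Vu–Turitsyn's polytope
`|(δ_i(0) − δ_j(0)) + (θ*_i − θ*_j)| < π`, lies on the momentum leaf
`Σ M_iω_i(0) + Σ D_iδ_i(0) = Σ D_iθ*_i`, and has classical energy `V(θ*; γ 0) ≤ 27/100` (the ★★ #80″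
polytope level: by p538862 the polytope and `V ≤ 27/100` persist and `γ → (θ*, 0)`) satisfies, for all
`t ≥ 0`:
`V(θ*; γ t) ≤ (42/5)·V(θ*; γ 0)·exp(−t/28)`.
Compared with ★ #110 (p550019: the same inequality from `{V ≤ 3/50} ∩ {|δ_i − δ_j| < π/2}`), the level is
`4.5×` larger and the window hypothesis is replaced by the polytope. LABEL: synthetic lossless VARIANT of
the printed 9-bus with the printed non-uniform damping — a PIPELINE sentence, not a 9-bus sentence;
`1/28 s⁻¹` is a LOWER bound on the model's rate in that region, not a damping figure of any grid; no
sentence here says a grid is stable or well damped.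
[cite: Khalil2002, Theorem 4.10]; [cite: VuTuritsyn2016, §IV]; [cite: SauerPai1998, §7.9.3, §9] -/
theorem energy_le_mul_exp_neg_polytope {γ : ℝ → ClassicalSwing.State 3}
    (hγ : data.toModel.IsSolutionOn γ univ)
    (hpol : ∀ i j, data.toModel.Ccoef i j ≠ 0 →
      |((γ 0).1 i - (γ 0).1 j) + (data.angleOf i - data.angleOf j)| < π)
    (hL : ∑ i, data.toModel.M i * (γ 0).2 i + ∑ i, data.toModel.D i * (γ 0).1 i
      = ∑ i, data.toModel.D i * data.angleOf i)
    (hV : data.toModel.energy data.angleOf (γ 0) ≤ 27 / 100) {t : ℝ} (ht : 0 ≤ t) :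
    data.toModel.energy data.angleOf (γ t)
      ≤ 42 / 5 * data.toModel.energy data.angleOf (γ 0) * Real.exp (-(1 / 28) * t) := by
  set p := Params.ofClassical data.toModel with hp
  have hwf : p.WellFormed := Params.wellFormed_ofClassical data.toModel M_pos D_pos B_symm
  have hδ₀ : p.IsSyncEquilibrium data.angleOf :=
    Params.isSyncEquilibrium_ofClassical data.toModel isLossless B_symm isEquilibrium
  have hb : ∀ i j, 0 ≤ p.b i j := fun i j => Ccoef_nonneg i j
  have h0 : ∀ i j, p.b i j ≠ 0 → |data.angleOf i - data.angleOf j| < π / 2 :=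
    fun i j hij => abs_angle_lt (ne_of_Ccoef_ne_zero hij)
  have hcgap : ∀ i j, p.b i j ≠ 0 →
      (27 / 100 : ℝ) < p.b i j * vtGap (data.angleOf i - data.angleOf j) :=
    fun i j hij => level_lt_pairGap (ne_of_Ccoef_ne_zero hij) hij
  have hhM : ∀ i ∈ p.gen, 2 * (1 / 20 : ℝ) * p.M i ≤ p.D i := fun i _ => by
    simpa [hp] using hM_ratio i
  -- the classical solution solves the structure-preserving phase field on every `[0, T]`
  have hX : ∀ T : ℝ, ∀ s ∈ Icc 0 T, HasDerivWithinAt γ (phaseField p (γ s)) (Icc 0 T) s :=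
    fun T s _ => by
      rw [hp, ClassicalSwingRoa.phaseField_ofClassical data.toModel isLossless B_symm isEquilibrium (γ s)]
      exact (hγ s (mem_univ s)).mono (subset_univ _)
  have hE : ∀ x : ClassicalSwing.State 3,
      phaseEnergy p data.angleOf x = data.toModel.energy data.angleOf x := fun x => by
    rw [StructurePreserving.phaseEnergy_apply, hp,
      Params.ofClassical_energy data.toModel isLossless B_symm isEquilibrium x.1 x.2]
  have hy : γ 0 ∈ vtPolytope p data.angleOf ∩ constraintSet p data.angleOf ∧
      phaseEnergy p data.angleOf (γ 0) ≤ 27 / 100 := by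
    refine ⟨⟨fun i j hij => hpol i j hij, ?_, fun i hi => absurd (Finset.mem_univ i) ?_⟩, ?_⟩
    · show p.momentum (γ 0).1 (γ 0).2 = p.momentum data.angleOf 0
      simp only [hp, Params.momentum, Params.ofClassical_gen, Params.ofClassical_M,
        Params.ofClassical_D, Pi.zero_apply, mul_zero, Finset.sum_const_zero, zero_add]
      exact hL
    · simp [hp] at hi
    · rw [hE]
      exact hV
  have hρK : (1 / 28 : ℝ) * (2 + 1 / 20 * (2 * (∑ i ∈ p.gen, p.M i) / (∑ i, p.D i))) ≤ 2 * (1 / 20) := by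
    rw [sum_M_gen, sum_D_all]; exact rate_ok.1
  have hρW : (1 / 28 : ℝ) * (1 + 1 / 20 * (4 * ((1 : ℕ) : ℝ) * (∑ i, p.D i)
      / (161205737693 / 200000000000)) / (209 / 1000)) ≤ 1 / 20 * 1 := by
    rw [sum_D_all]; exact rate_ok.2
  have hCK : 2 + 1 / 20 * (2 * (∑ i ∈ p.gen, p.M i) / (∑ i, p.D i)) ≤ (14 / 5 : ℝ) := by
    rw [sum_M_gen, sum_D_all]; exact gain_ok.1
  have hCW : 1 + 1 / 20 * (4 * ((1 : ℕ) : ℝ) * (∑ i, p.D i) / (161205737693 / 200000000000))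
      / (209 / 1000) ≤ (14 / 5 : ℝ) := by
    rw [sum_D_all]; exact gain_ok.2
  have hmain := phaseEnergy_le_mul_exp_neg_vt_diam hwf (by decide) hb
    (β := 161205737693 / 200000000000) (by norm_num) edge_lower diam_one h0 hδ₀ hcgap cert
    (by norm_num) (h := 1 / 20) (by norm_num) hhM (ρ := 1 / 28) (by norm_num) hρK hρW hCK hCW hy hX ht
  rw [hE, hE] at hmain
  have e : (3 : ℝ) * (14 / 5) = 42 / 5 := by norm_num
  rw [e] at hmain
  exact hmain

end Summit.Ventures.GridStability.Lyapunov.WSCC9LosslessPolytopeRate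

end
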